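import Mathlib
import Literature.Computability.AlgebraicComplexity.StandardFamilies
import Literature.Computability.AlgebraicComplexity.HessianRank
import Literature.Computability.AlgebraicComplexity.MignonRessayreBound
import Literature.RingTheory.Nullstellensatz.SkodaBrownawellDegreeBound
import Summits.ValiantsHypothesis.ValiantsHypothesis.Theses.RefutationDegree
import Summits.ValiantsHypothesis.ValiantsHypothesis.Theorems.RefutationDegreeDefs
import Summits.ValiantsHypothesis.ValiantsHypothesis.Theorems.RefutationDegreeRefutationBarrierConverse
import Summits.ValiantsHypothesis.ValiantsHypothesis.Theorems.RefutationDegreeBeyondHessianNsKernelPlane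
import Summits.ValiantsHypothesis.ValiantsHypothesis.Theorems.RefutationDegreeRefutationBarrierStubBorderKernelPlane
import Summits.ValiantsHypothesis.ValiantsHypothesis.Theorems.RefutationDegreeRefutationBarrierStubIsotropicOfNull

/-!
# Route `RefutationDegree`, crux `RefutationBarrier`, line `Sketch_ideator4` (idea `fano-by-one-border`):
the border Fano bound and the reduction of `¬ RefutationBarrier` to `FanoByOne` infinitely often

With the border-robust kernel plane (L1, `stub_borderKernelPlane`) and the isotropy bound
(`stub_isotropic_of_null`) landed, this file records the closed consequences of the line:

* `null_sup_span_of_flat` (L2, homogeneity closure): a flat `y + W` on the cone `{f = 0}` of a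
  homogeneous `f` generates the LINEAR null subspace `W ⊔ Ky`;
* `sq_le_add_of_inBorder` — **the border Fano bound** `\overline{dc}_aff(per_n) ≥ n² − 𝔣_lin(y)`:
  if `InBorder n m` and every linear per-null subspace through the zero `y` has dimension `≤ d`, then
  `n² ≤ m + d` (border analogue of the landed exact bound `sq_le_add_of_hasDetRepr_perPoly`);
* `sq_le_two_mul_of_inBorder_of_det_ne_zero` / `sq_le_two_mul_of_inBorder` — **the quadratic border
  bound in the route's affine-border model**: `InBorder n m → n² ≤ 2m` for `n ≥ 3` (Landsberg–Manivel–
  Ressayre 2013, Thm 1.1.1, here re-proved by kernel planes + Grassmannian compactness + Hessian isotropy at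
  the Mignon–Ressayre point, `hessianMatrix_perPoly_mrPoint`);
* `not_inBorder_of_fanoByOne` — at odd `n`, `FanoByOne n` (some zero `y` with `𝔣_lin(y) ≤ ⌊n²/2⌋ − 1`)
  gives `¬ InBorder n (⌊n²/2⌋+1)`, i.e. LMR13 plus one;
* `not_refutationBarrier_of_fanoByOne_io` — `FanoByOne` at infinitely many odd `n` REFUTES the crux,
  modulo the named analytic fact `skodaBrownawellDegreeBound` (landed `not_refutationBarrier_of_io_notInBorder`).

The research content of the line is thereby isolated in the single per-side statement `FanoByOne` i.o.
(registered stub `stub_fanoByOne_io` of `Cruxes/RefutationBarrier/Lines/Sketch_ideator4.lean`).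
-/

set_option linter.dupNamespace false

noncomputable section

namespace Summit.ValiantsHypothesis.ValiantsHypothesis.Theorems.RefutationDegree

open scoped BigOperators
open Filter Topology MvPolynomial Matrix
open Literature.Computability.AlgebraicComplexity
open Summit.ValiantsHypothesis.ValiantsHypothesis.Theorems.RefutationDegreeBeyondHessianNs (eval_aeval_line)
open Literature.RingTheory.Nullstellensatz (skodaBrownawellDegreeBound)
open Summit.ValiantsHypothesis.ValiantsHypothesis.Theses.RefutationDegree

/-! ### L2 — homogeneity closure -/

/-- **Homogeneity closure.**  If a homogeneous polynomial `f` over an infinite field vanishes on the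
affine flat `y + W`, then it vanishes on the LINEAR subspace `W ⊔ Ky`: `a•y + z = a•(y + a⁻¹•z)` is a
zero for `a ≠ 0` by homogeneity, and `t ↦ f(t•y + z)` has infinitely many roots, so it vanishes at
`t = 0` too. [folklore] -/
theorem null_sup_span_of_flat {K : Type*} [Field K] [Infinite K] {σ : Type*} {f : MvPolynomial σ K}
    {d : ℕ} (hf : f.IsHomogeneous d) (y : σ → K) (W : Submodule K (σ → K))
    (hW : ∀ w ∈ W, eval (y + w) f = 0) : ∀ w ∈ W ⊔ (K ∙ y), eval w f = 0 := by
  classical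
  intro w hw
  obtain ⟨z, hz, y', hy', rfl⟩ := Submodule.mem_sup.mp hw
  obtain ⟨a, rfl⟩ := Submodule.mem_span_singleton.mp hy'
  have hne : ∀ a : K, a ≠ 0 → eval (a • y + z) f = 0 := by
    intro a ha
    have hx : a • y + z = a • (y + a⁻¹ • z) := by
      rw [smul_add, smul_smul, mul_inv_cancel₀ ha, one_smul]
    rw [hx, eval_smul_of_isHomogeneous hf, hW _ (W.smul_mem _ hz), mul_zero]
  have key : eval (a • y + z) f = 0 := by
    by_cases ha : a = 0
    · subst ha
      set G := aeval (fun e => Polynomial.C (y e) * Polynomial.X + Polynomial.C (z e)) f with hG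
      have hG0 : G = 0 := by
        apply Polynomial.eq_zero_of_infinite_isRoot
        refine Set.Infinite.mono (s := {t : K | t ≠ 0}) ?_ ?_
        · intro t ht
          simp only [Set.mem_setOf_eq, Polynomial.IsRoot.def]
          rw [hG, eval_aeval_line, hne t ht]
        · have : ({t : K | t ≠ 0}) = ({0} : Set K)ᶜ := by ext; simp
          rw [this]
          exact (Set.finite_singleton (0 : K)).infinite_compl
      have := eval_aeval_line f y z 0
      rw [← hG, hG0, Polynomial.eval_zero] at this
      rw [← this]
    · exact hne a ha
  rw [add_comm]
  exact key

/-! ### The border Fano bound -/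

/-- **The border Fano bound** `\overline{dc}_aff(per_n) ≥ n² − 𝔣_lin(y)`: if `per_n` is a
coefficientwise limit of determinants of size-`m` affine pencils and every LINEAR per-null subspace
through the zero `y` has dimension `≤ d`, then `n² ≤ m + d` (border version of
`RefutationDegreeBeyondHessianNs.sq_le_add_of_hasDetRepr_perPoly`). [folklore] -/
theorem sq_le_add_of_inBorder {n m d : ℕ} (h : InBorder n m) (y : Fin n × Fin n → ℂ)
    (hy : eval y (perPoly (Fin n) ℂ) = 0)
    (hd : ∀ W : Submodule ℂ (Fin n × Fin n → ℂ), y ∈ W →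
      (∀ w ∈ W, eval w (perPoly (Fin n) ℂ) = 0) → Module.finrank ℂ W ≤ d) :
    n ^ 2 ≤ m + d := by
  have hhom : (perPoly (Fin n) ℂ).IsHomogeneous n := by
    simpa [Fintype.card_fin] using (perPoly_isHomogeneous (n := Fin n) (k := ℂ))
  obtain ⟨W, hdim, hflat⟩ := stub_borderKernelPlane h y hy
  have hnull := null_sup_span_of_flat hhom y W hflat
  have hyW' : y ∈ W ⊔ (ℂ ∙ y) := Submodule.mem_sup_right (Submodule.mem_span_singleton_self y)
  have hle : Module.finrank ℂ W ≤ Module.finrank ℂ (W ⊔ (ℂ ∙ y) : Submodule ℂ _) :=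
    Submodule.finrank_mono le_sup_left
  have := hd _ hyW' hnull
  omega

/-- **Off the border by a Fano witness**: if some zero `y` of `per_n` has all its linear per-null
subspaces of dimension `≤ d` and `m + d < n²`, then `per_n` is NOT a coefficientwise limit of size-`m`
affine determinantal expressions. [folklore] -/
theorem not_inBorder_of_finrank_le {n m d : ℕ} (hlt : m + d < n ^ 2)
    (hF : ∃ y : Fin n × Fin n → ℂ, eval y (perPoly (Fin n) ℂ) = 0 ∧
      ∀ W : Submodule ℂ (Fin n × Fin n → ℂ), y ∈ W →
        (∀ w ∈ W, eval w (perPoly (Fin n) ℂ) = 0) → Module.finrank ℂ W ≤ d) :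
    ¬ InBorder n m := fun hB => by
  obtain ⟨y, hy, hd⟩ := hF
  have := sq_le_add_of_inBorder hB y hy hd
  omega

/-- **Quadratic border bound at a non-degenerate zero**: if `InBorder n m` and some zero `y` of `per_n`
has non-degenerate Hessian, then `n² ≤ 2m` (the linear per-null subspaces through `y` are totally
isotropic, `stub_isotropic_of_null`). [folklore] -/
theorem sq_le_two_mul_of_inBorder_of_det_ne_zero {n m : ℕ} (h : InBorder n m)
    (y : Fin n × Fin n → ℂ) (hy : eval y (perPoly (Fin n) ℂ) = 0)
    (hH : (hessianMatrix (perPoly (Fin n) ℂ) y).det ≠ 0) : n ^ 2 ≤ 2 * m := by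
  classical
  have hb := sq_le_add_of_inBorder (d := n ^ 2 / 2) h y hy fun W hyW hW => by
    have := stub_isotropic_of_null (perPoly (Fin n) ℂ) y hH W hyW hW
    simp only [Fintype.card_prod, Fintype.card_fin, ← sq] at this
    omega
  omega

/-- **The Hessian of `per_{m+3}` at the Mignon–Ressayre point** in the `hessianMatrix` vocabulary:
`Hess per (y₀) = m! · mrHess` (tree: `hess0_transl_mrPoint_perPoly`). [folklore] -/
theorem hessianMatrix_perPoly_mrPoint (m : ℕ) :
    hessianMatrix (perPoly (Fin (m + 3)) ℂ) (mrPoint ℂ m) = (m.factorial : ℂ) • mrHess ℂ m := by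
  classical
  ext s t
  rw [hessianMatrix_apply, ← hess0_transl, hess0_transl_mrPoint_perPoly]

/-- The Hessian of `per_{m+3}` at the Mignon–Ressayre point is NON-DEGENERATE (Mignon–Ressayre 2004,
§3; Landsberg 2017, Lemma 6.4.6.3: `mrHess` is invertible in characteristic `0`). [folklore] -/
theorem det_hessianMatrix_perPoly_mrPoint_ne_zero (m : ℕ) :
    (hessianMatrix (perPoly (Fin (m + 3)) ℂ) (mrPoint ℂ m)).det ≠ 0 := by
  classical
  rw [hessianMatrix_perPoly_mrPoint, Matrix.det_smul]
  refine mul_ne_zero (pow_ne_zero _ (by exact_mod_cast m.factorial_ne_zero)) ?_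
  have hU : IsUnit (mrHess ℂ m) :=
    Matrix.mulVec_injective_iff_isUnit.mp mrHess_mulVec_injective
  exact ((Matrix.isUnit_iff_isUnit_det _).mp hU).ne_zero

/-- **The quadratic BORDER bound in the route's affine-border model** (Landsberg–Manivel–Ressayre 2013,
Theorem 1.1.1, re-proved here by kernel planes): for `n ≥ 3`, if `per_n` is a coefficientwise limit of
determinants of size-`m` affine pencils then `n² ≤ 2m`, i.e. `\overline{dc}_aff(per_n) ≥ n²/2`. [folklore] -/
theorem sq_le_two_mul_of_inBorder {n m : ℕ} (hn : 3 ≤ n) (h : InBorder n m) : n ^ 2 ≤ 2 * m := by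
  obtain ⟨k, rfl⟩ : ∃ k, n = k + 3 := ⟨n - 3, by omega⟩
  exact sq_le_two_mul_of_inBorder_of_det_ne_zero h (mrPoint ℂ k) eval_mrPoint_perPoly
    (det_hessianMatrix_perPoly_mrPoint_ne_zero k)

/-! ### `FanoByOne` and the crux -/

/-- **`FanoByOne` at odd `n` puts `per_n` OFF the affine border at the quadratic size `⌊n²/2⌋+1`**:
if some zero `y` of `per_n` lies on no linear per-null subspace of dimension `⌊n²/2⌋` (every linear
`W ∋ y` with `per_n|_W ≡ 0` has `dim W + 1 ≤ ⌊n²/2⌋`), then `¬ InBorder n (⌊n²/2⌋+1)` —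
Landsberg–Manivel–Ressayre's bound plus one. [folklore] -/
theorem not_inBorder_of_fanoByOne {n : ℕ} (hn : Odd n)
    (hF : ∃ y : Fin n × Fin n → ℂ, eval y (perPoly (Fin n) ℂ) = 0 ∧
      ∀ W : Submodule ℂ (Fin n × Fin n → ℂ), y ∈ W →
        (∀ w ∈ W, eval w (perPoly (Fin n) ℂ) = 0) → Module.finrank ℂ W + 1 ≤ n ^ 2 / 2) :
    ¬ InBorder n (n ^ 2 / 2 + 1) := by
  intro hB
  obtain ⟨y, hy, hmax⟩ := hF
  have hsq : n ^ 2 % 2 = 1 := Nat.odd_iff.mp hn.pow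
  rcases Nat.eq_zero_or_pos (n ^ 2 / 2) with h0 | hpos
  · -- `n = 1`: `FanoByOne 1` is vacuously false (`W = ℂy` has dimension `1`)
    have := hmax (ℂ ∙ y) (Submodule.mem_span_singleton_self y) fun w hw => by
      obtain ⟨a, rfl⟩ := Submodule.mem_span_singleton.mp hw
      have hhom : (perPoly (Fin n) ℂ).IsHomogeneous n := by
        simpa [Fintype.card_fin] using (perPoly_isHomogeneous (n := Fin n) (k := ℂ))
      rw [eval_smul_of_isHomogeneous hhom, hy, mul_zero]
    omega
  · have hb := sq_le_add_of_inBorder (d := n ^ 2 / 2 - 1) hB y hy fun W hyW hW => by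
      have := hmax W hyW hW
      omega
    omega

/-- **`FanoByOne` at infinitely many odd `n` REFUTES the crux `RefutationBarrier`**, modulo the named
analytic fact `skodaBrownawellDegreeBound` (through the landed `not_refutationBarrier_of_io_notInBorder`:
off the border, Skoda–Brownawell gives Hermitian-SOS refutations of degree `≤ n⁹`). [folklore] -/
theorem not_refutationBarrier_of_fanoByOne_io
    (hSB : ∀ n m : ℕ, skodaBrownawellDegreeBound (σ := Unk n m) (ι := (Fin n × Fin n) →₀ ℕ))
    (hF : ∀ n₀ : ℕ, ∃ n ≥ n₀, Odd n ∧
      ∃ y : Fin n × Fin n → ℂ, eval y (perPoly (Fin n) ℂ) = 0 ∧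
        ∀ W : Submodule ℂ (Fin n × Fin n → ℂ), y ∈ W →
          (∀ w ∈ W, eval w (perPoly (Fin n) ℂ) = 0) → Module.finrank ℂ W + 1 ≤ n ^ 2 / 2) :
    ¬ RefutationBarrier :=
  not_refutationBarrier_of_io_notInBorder hSB fun n₀ => by
    obtain ⟨n, hn, hodd, hFn⟩ := hF n₀
    exact ⟨n, hn, not_inBorder_of_fanoByOne hodd hFn⟩

end Summit.ValiantsHypothesis.ValiantsHypothesis.Theorems.RefutationDegree

end
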